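import Summits.HodgeConjecture.HodgeConjecture.Theorems.R90S6TwistedUnitSelfDualCount    -- ★ K1 `ncard_isSelfDualLattice_mul_inv_eq_of_formCongr` (conditional transport; brings ★ W9 `R90S6TwistedPolarity`: `transpose_map_mul_antidiagonal_mul_qsInvolution`, `UnitaryGroup.qsInvolution`, `formCongr`)
import Literature.NumberTheory.Automorphic.LocalFieldHermitianClassification            -- ★ `UnitaryGroup.nonempty_formCongr_eq_iff_det_three_localField` (Jacobowitz: ternary hermitian forms over a p-adic field are classified by the discriminant mod norms)
import HarnessLib

/-!
# R90 · S6 «Ch. 14.1–14.5 stable trace formula» — card K2 (row E1.4.3.3.2): THE GRAM DATUM OF THE TWISTED POLARITY AND THE HERMITIAN-NESS OF `h_δ`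
# (`Theorems/R90S6TwistedUnitFrameExists.lean`)

Pure matrix algebra behind ★ K1 `Theorems/R90S6TwistedUnitSelfDualCount` (the unit twisted orbital integral as a count of `h_δ`-self-dual lattices,
`h_δ = J₀·δ⁻¹`) over ANY field `K` with a ring endomorphism `σ`, `J₀ = w⁰ = (StdForm.antidiagonal N).over K`, `Θ_σ = UnitaryGroup.qsInvolution σ`
(`Θ_σ(g) = w⁰ ᵗ(σg)⁻¹ w⁰`), `N(δ) = δ·Θ_σ(δ)` the norm, `formCongr σ g H = ᵗ(σg)·H·g` the Gram matrix of `H` in the frame `g`: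

* §1 **`formCongr_antidiagonal_mul_inv`** — for EVERY `δ, g ∈ GL_N(K)`: `ᵗ(σg)·(J₀δ⁻¹)·g = J₀·k⁻¹` with `k := g⁻¹·δ·Θ_σ(g)` — the Gram matrix of `h_δ` in the
  frame `g` is `J₀` times the inverse of the TWISTED SHELL DATUM `k` of ★ J1′∕J2′∕K1 (so «`g·𝒪^N` is `h_δ`-self-dual» ⟺ `k ∈ GL_N(𝒪)`, K1's count, for every
  class; and `k·Θ_σ(k) = g⁻¹·N(δ)·g`: a Θ-twisted cocycle RELATIVE TO the norm `γ = N(δ)` — the datum through which the general [Kt₁] matching runs);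
* §2 **`map_transpose_antidiagonal_mul_inv_eq_iff`** — `h_δ = J₀·δ⁻¹` is `σ`-HERMITIAN iff `N(δ) = δ·Θ_σ(δ) = 1` (any `σ`).  Hence the frame
  hypothesis of ★ K1 (3′) `formCongr σ g₀ J₀ = J₀·δ⁻¹` (a Gram matrix is hermitian) can only hold in the twisted class of TRIVIAL norm; for ε-regular `δ` the set
  `Fix(P_δ)` is not the self-dual set of a hermitian form on `K^N` (honest scope of K1 (3′)).

* §3 (N = 3, `p`-adic `E` of characteristic 0, `σ` an involution `≠ id`) **`exists_formCongr_eq_antidiagonal_mul_inv_iff`** — in the trivial-norm class the frame of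
  ★ K1 (3′) EXISTS iff the discriminant allows it: `N(δ) = 1 ⇒ ((∃ g₀, ᵗ(σg₀)·J₀·g₀ = J₀·δ⁻¹) ⟺ ∃ z ≠ 0, det δ⁻¹ = σz·z)` (★ Jacobowitz
  `UnitaryGroup.nonempty_formCongr_eq_iff_det_three_localField`: ternary hermitian forms over a `p`-adic field are classified by the discriminant modulo norms; the
  parity is load-bearing: `δ = diag(1, ϖ, 1)` has `N(δ) = 1`, `det δ = ϖ ∉ N(E^×)`, no frame and no `h_δ`-unimodular lattice), and the corollary
  **`ncard_isSelfDualLattice_mul_inv_eq_ncard_std_of_epsNorm_eq_one`** — then `#{h_δ-self-dual framed lattices} = #{J₀-self-dual framed lattices}` (★ K1 (3′)), so by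
  ★ K1 (2′) the unit twisted orbital integral of the TRIVIAL-NORM class counts hyperspecial vertices of the standard building.  HONEST SCOPE: ε-regular `δ` are NOT
  covered by §3 (by §2 their `h_δ` is not hermitian); their matching is row E1.4.3.3.2's second half, through the Gram datum of §1.

Cell `hodgecm-mathlib`, crux H413 (`stmt-HodgeConjecture-24833`), route of record `HCCMUnconditional`; programme R90-TF, section S6 (base `R90-C14`, dealer
R90-C14-plan (g2), card K2 2026-09-05T00:52:55Z), seat R90-C14-p08 (g0).  Lane `--kind proof --supports stmt-HodgeConjecture-24833 --as helper`; THEOREMS ONLY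
(no definition, no instance, no notation, no named fact, no `sorry`).
HONEST LABEL: algebra, count-neutral until E1.4.3.3.2 closes; HC_CM is proved only modulo the 7 printed citations (2 remaining named inputs: hLiu418 =
stmt-HodgeConjecture-24832, h413 = stmt-HodgeConjecture-24833) until rung 0 closes.

## References
* [Kottwitz1986BaseChangeUnits] R. E. Kottwitz, *Base change for unit elements of Hecke algebras*, Compositio Math. 60 (1986): §1 pp. 239–243.
* [Rogawski1990] J. D. Rogawski, *Automorphic Representations of Unitary Groups in Three Variables* (1990): §1.9 p. 8 (`Θ`, `w⁰`), §3.10 p. 33 (`N(δ) = δε(δ)`).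
* [Jacobowitz1962] R. Jacobowitz, *Hermitian forms over local fields*, Amer. J. Math. 84 (1962): §3 Thm. 3.1 (classification by the discriminant), §7.
-/

set_option autoImplicit false
-- the mandated namespace repeats the single-problem summit's segment (`HodgeConjecture.HodgeConjecture`)
set_option linter.dupNamespace false

noncomputable section

open scoped Matrix MatrixGroups Valued WithZero
open Literature.NumberTheory.Automorphic Literature.NumberTheory.Automorphic.HermitianLattice

namespace Summit.HodgeConjecture.HodgeConjecture.R90.S6

variable {K : Type*} [Field K] {σ : K →+* K} {N : ℕ}

/-! ## §1 The Gram matrix of `h_δ = J₀·δ⁻¹` in a frame `g` -/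

/-- `ᵗ(σg)·J₀ = J₀·Θ_σ(g)⁻¹` (★ `transpose_map_mul_antidiagonal_mul_qsInvolution` with `Θ_σ(g)` moved across). [cite: Rogawski1990, §1.9 p. 8] -/
theorem transpose_map_mul_antidiagonal_eq_mul_qsInvolution_inv (g : GL (Fin N) K) :
    ((g : Matrix (Fin N) (Fin N) K).map σ)ᵀ * (StdForm.antidiagonal N).over K =
      (StdForm.antidiagonal N).over K * (((UnitaryGroup.qsInvolution σ g)⁻¹ : GL (Fin N) K) : Matrix (Fin N) (Fin N) K) := by
  have h := transpose_map_mul_antidiagonal_mul_qsInvolution (σ := σ) g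
  have hinv : ((UnitaryGroup.qsInvolution σ g : GL (Fin N) K) : Matrix (Fin N) (Fin N) K) *
      (((UnitaryGroup.qsInvolution σ g)⁻¹ : GL (Fin N) K) : Matrix (Fin N) (Fin N) K) = 1 := by
    rw [← Units.val_mul, mul_inv_cancel, Units.val_one]
  calc ((g : Matrix (Fin N) (Fin N) K).map σ)ᵀ * (StdForm.antidiagonal N).over K
      = ((g : Matrix (Fin N) (Fin N) K).map σ)ᵀ * (StdForm.antidiagonal N).over K *
          (((UnitaryGroup.qsInvolution σ g : GL (Fin N) K) : Matrix (Fin N) (Fin N) K) *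
            (((UnitaryGroup.qsInvolution σ g)⁻¹ : GL (Fin N) K) : Matrix (Fin N) (Fin N) K)) := by rw [hinv, Matrix.mul_one]
    _ = ((g : Matrix (Fin N) (Fin N) K).map σ)ᵀ * (StdForm.antidiagonal N).over K *
          ((UnitaryGroup.qsInvolution σ g : GL (Fin N) K) : Matrix (Fin N) (Fin N) K) *
            (((UnitaryGroup.qsInvolution σ g)⁻¹ : GL (Fin N) K) : Matrix (Fin N) (Fin N) K) := by simp only [Matrix.mul_assoc]
    _ = (StdForm.antidiagonal N).over K * (((UnitaryGroup.qsInvolution σ g)⁻¹ : GL (Fin N) K) : Matrix (Fin N) (Fin N) K) := by rw [h]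

/-- **K2 §1 — THE GRAM DATUM: `ᵗ(σg)·(J₀·δ⁻¹)·g = J₀·(g⁻¹·δ·Θ_σ(g))⁻¹`** for all `δ, g ∈ GL_N(K)` (any field, any `σ`).  The Gram matrix of `h_δ = J₀δ⁻¹` in the
frame `g` is `J₀·k⁻¹` for the twisted shell datum `k = g⁻¹δΘ_σ(g)` of ★ J1′∕J2′∕K1; in particular «`g·𝒪^N` is `h_δ`-unimodular ⟺ `k ∈ GL_N(𝒪)`» for EVERY twisted class,
and `k·Θ_σ(k) = g⁻¹·N(δ)·g`. [cite: Kottwitz1986BaseChangeUnits, §1 pp. 240–242] [cite: Rogawski1990, §1.9 p. 8] -/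
theorem formCongr_antidiagonal_mul_inv (δ g : GL (Fin N) K) :
    formCongr σ g ((StdForm.antidiagonal N).over K * (((δ⁻¹ : GL (Fin N) K)) : Matrix (Fin N) (Fin N) K)) =
      (StdForm.antidiagonal N).over K * ((((g⁻¹ * δ * UnitaryGroup.qsInvolution σ g)⁻¹ : GL (Fin N) K)) : Matrix (Fin N) (Fin N) K) := by
  rw [formCongr, ← Matrix.mul_assoc, transpose_map_mul_antidiagonal_eq_mul_qsInvolution_inv, mul_inv_rev, mul_inv_rev, inv_inv,
    Units.val_mul, Units.val_mul]
  simp only [Matrix.mul_assoc]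

/-- The norm relation of the Gram datum: `k·Θ_σ(k) = g⁻¹·N(δ)·g` for `k = g⁻¹δΘ_σ(g)`, `N(δ) = δΘ_σ(δ)`, when `Θ_σ ∘ Θ_σ = id` (e.g. `σ` an involution; supplied
as the hypothesis `hΘΘ` at `g`). [cite: Rogawski1990, §3.10 p. 33] -/
theorem gramDatum_mul_qsInvolution_eq (δ g : GL (Fin N) K) (hΘΘ : UnitaryGroup.qsInvolution σ (UnitaryGroup.qsInvolution σ g) = g) :
    (g⁻¹ * δ * UnitaryGroup.qsInvolution σ g) * UnitaryGroup.qsInvolution σ (g⁻¹ * δ * UnitaryGroup.qsInvolution σ g) =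
      g⁻¹ * (δ * UnitaryGroup.qsInvolution σ δ) * g := by
  have hΘ1 : UnitaryGroup.qsInvolution σ (1 : GL (Fin N) K) = 1 := by
    have h := UnitaryGroup.qsInvolution_mul (σ := σ) (1 : GL (Fin N) K) 1
    rw [one_mul] at h
    exact mul_left_cancel (a := UnitaryGroup.qsInvolution σ 1) (h.symm.trans (mul_one _).symm)
  have hinv : UnitaryGroup.qsInvolution σ g⁻¹ = (UnitaryGroup.qsInvolution σ g)⁻¹ :=
    eq_inv_of_mul_eq_one_left (by rw [← UnitaryGroup.qsInvolution_mul, inv_mul_cancel, hΘ1])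
  rw [UnitaryGroup.qsInvolution_mul, UnitaryGroup.qsInvolution_mul, hinv, hΘΘ]
  group

/-! ## §2 `h_δ` is hermitian iff `N(δ) = 1` -/

/-- **K2 §2 — `h_δ = J₀·δ⁻¹` IS `σ`-HERMITIAN IFF `N(δ) = δ·Θ_σ(δ) = 1`** (any field, any ring endomorphism `σ`): `((J₀δ⁻¹).map σ)ᵀ = ᵗ(σδ⁻¹)·J₀ = J₀·Θ_σ(δ⁻¹)⁻¹ = J₀·Θ_σ(δ)` (`transpose_map_mul_antidiagonal_eq_mul_qsInvolution_inv`,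
`Θ_σ` multiplicative), so hermitian-ness reads `J₀·Θ_σ(δ) = J₀·δ⁻¹`, i.e. `Θ_σ(δ) = δ⁻¹`, i.e. `N(δ) = 1`.  Consequently the frame hypothesis `formCongr σ g₀ J₀ = J₀·δ⁻¹` of ★ K1 (3′) (a Gram matrix of a hermitian form is hermitian)
forces `N(δ) = 1`: K1 (3′) addresses the twisted class of trivial norm only. [cite: Rogawski1990, §1.9 p. 8; §3.10 p. 33] [cite: Kottwitz1986BaseChangeUnits, §1 p. 242] -/
theorem map_transpose_antidiagonal_mul_inv_eq_iff (δ : GL (Fin N) K) :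
    (((StdForm.antidiagonal N).over K * (((δ⁻¹ : GL (Fin N) K)) : Matrix (Fin N) (Fin N) K)).map σ)ᵀ =
        (StdForm.antidiagonal N).over K * (((δ⁻¹ : GL (Fin N) K)) : Matrix (Fin N) (Fin N) K) ↔
      δ * UnitaryGroup.qsInvolution σ δ = 1 := by
  have hJ : (((StdForm.antidiagonal N).over K).map σ)ᵀ = (StdForm.antidiagonal N).over K := by
    rw [StdForm.over_map, StdForm.transpose_over]
  have hΘ1 : UnitaryGroup.qsInvolution σ (1 : GL (Fin N) K) = 1 := by
    have h := UnitaryGroup.qsInvolution_mul (σ := σ) (1 : GL (Fin N) K) 1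
    rw [one_mul] at h
    exact mul_left_cancel (a := UnitaryGroup.qsInvolution σ 1) (h.symm.trans (mul_one _).symm)
  have hΘinv : UnitaryGroup.qsInvolution σ δ⁻¹ = (UnitaryGroup.qsInvolution σ δ)⁻¹ :=
    eq_inv_of_mul_eq_one_left (by rw [← UnitaryGroup.qsInvolution_mul, inv_mul_cancel, hΘ1])
  -- `ᵗ(σ(J₀δ⁻¹)) = ᵗ(σδ⁻¹)·J₀ = J₀·Θ_σ(δ)`
  have hL : (((StdForm.antidiagonal N).over K * (((δ⁻¹ : GL (Fin N) K)) : Matrix (Fin N) (Fin N) K)).map σ)ᵀ =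
      (StdForm.antidiagonal N).over K * ((UnitaryGroup.qsInvolution σ δ : GL (Fin N) K) : Matrix (Fin N) (Fin N) K) := by
    rw [Matrix.map_mul, Matrix.transpose_mul, hJ, transpose_map_mul_antidiagonal_eq_mul_qsInvolution_inv, hΘinv, inv_inv]
  -- `J₀` is invertible: cancel it on the left
  have hJu : IsUnit ((StdForm.antidiagonal N).over K) := (StdForm.antidiagonal N).isUnit_over K
  rw [hL]
  constructor
  · intro h
    have h' : ((UnitaryGroup.qsInvolution σ δ : GL (Fin N) K) : Matrix (Fin N) (Fin N) K) = (((δ⁻¹ : GL (Fin N) K)) : Matrix (Fin N) (Fin N) K) :=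
      hJu.mul_left_cancel h
    have hΘ : UnitaryGroup.qsInvolution σ δ = δ⁻¹ := Units.ext h'
    rw [hΘ, mul_inv_cancel]
  · intro h
    rw [show UnitaryGroup.qsInvolution σ δ = δ⁻¹ from eq_inv_of_mul_eq_one_right h]

/-! ## §3 The trivial-norm class at `N = 3` over a `p`-adic field: the frame exists iff the discriminant is a norm -/

section Frame

open Literature.NumberTheory.Automorphic.UnitaryLatticeTree

variable {E : Type} [Field E] [ValuativeRel E] [TopologicalSpace E] [IsNonarchimedeanLocalField E] [CharZero E] {τ : E →+* E}

/-- **K2 §3 — THE FRAME EXISTS IFF THE DISCRIMINANT IS A NORM** (`N = 3`, `E` a `p`-adic field of characteristic `0`, `τ` an involution `≠ id`, `δ` of TRIVIAL norm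
`δ·Θ_τ(δ) = 1`): `(∃ g₀ ∈ GL₃(E), ᵗ(τg₀)·J₀·g₀ = J₀·δ⁻¹) ⟺ ∃ z ≠ 0, det δ⁻¹ = τz·z` — `J₀·δ⁻¹` is hermitian by §2 and non-degenerate, and ternary hermitian forms over
`E ∕ E^τ` are classified by the discriminant modulo norms (★ `UnitaryGroup.nonempty_formCongr_eq_iff_det_three_localField`, Jacobowitz), `det J₀ ≠ 0` cancelling.
[cite: Jacobowitz1962, §3 Thm. 3.1] [cite: Kottwitz1986BaseChangeUnits, §3 pp. 246–248] -/
theorem exists_formCongr_eq_antidiagonal_mul_inv_iff (hτ : ∀ x, τ (τ x) = x) (hτ1 : τ ≠ RingHom.id E) (δ : GL (Fin 3) E)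
    (hN : δ * UnitaryGroup.qsInvolution τ δ = 1) :
    (∃ g₀ : GL (Fin 3) E, formCongr τ g₀ ((StdForm.antidiagonal 3).over E) =
        (StdForm.antidiagonal 3).over E * (((δ⁻¹ : GL (Fin 3) E)) : Matrix (Fin 3) (Fin 3) E)) ↔
      ∃ z : E, z ≠ 0 ∧ ((((δ⁻¹ : GL (Fin 3) E)) : Matrix (Fin 3) (Fin 3) E)).det = τ z * z := by
  have hJ : (((StdForm.antidiagonal 3).over E).map τ)ᵀ = (StdForm.antidiagonal 3).over E := by
    rw [StdForm.over_map, StdForm.transpose_over]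
  have hJd : ((StdForm.antidiagonal 3).over E).det ≠ 0 :=
    ((Matrix.isUnit_iff_isUnit_det _).1 ((StdForm.antidiagonal 3).isUnit_over E)).ne_zero
  have hH' : (((StdForm.antidiagonal 3).over E * (((δ⁻¹ : GL (Fin 3) E)) : Matrix (Fin 3) (Fin 3) E)).map τ)ᵀ =
      (StdForm.antidiagonal 3).over E * (((δ⁻¹ : GL (Fin 3) E)) : Matrix (Fin 3) (Fin 3) E) :=
    (map_transpose_antidiagonal_mul_inv_eq_iff δ).2 hN
  have hH'd : ((StdForm.antidiagonal 3).over E * (((δ⁻¹ : GL (Fin 3) E)) : Matrix (Fin 3) (Fin 3) E)).det ≠ 0 := by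
    rw [Matrix.det_mul]
    exact mul_ne_zero hJd (Matrix.isUnits_det_units _).ne_zero
  rw [UnitaryGroup.nonempty_formCongr_eq_iff_det_three_localField hτ hτ1 hJ hJd hH' hH'd, Matrix.det_mul]
  refine exists_congr fun z => and_congr_right fun _ => ?_
  rw [mul_comm ((StdForm.antidiagonal 3).over E).det, mul_left_inj' hJd]

end Frame

section FrameCount

open Literature.NumberTheory.Automorphic.UnitaryLatticeTree

-- the topology of `E` is the one of its `Valued` structure (the lattice files' currency); the `p`-adic structure is a mixin over it
variable {E : Type} [Field E] [Valued E ℤᵐ⁰] [ValuativeRel E] [IsNonarchimedeanLocalField E] [CharZero E] {τ : E →+* E}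

/-- **K2 §3, corollary — IN THE TRIVIAL-NORM CLASS THE `h_δ`-SELF-DUAL LATTICES ARE AS MANY AS THE `J₀`-SELF-DUAL ONES** (`N = 3`; `E` carrying, besides its
`p`-adic structure, the `Valued E ℤᵐ⁰` structure of the lattice files; `N(δ) = 1` and `det δ⁻¹ ∈ N(E^×)`): the frame of `exists_formCongr_eq_antidiagonal_mul_inv_iff`
feeds ★ K1 (3′) `ncard_isSelfDualLattice_mul_inv_eq_of_formCongr`.  With ★ K1 (2′) this reads: the unit twisted orbital integral of the trivial-norm class = `ν(GL₃(𝒪))`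
times the number of hyperspecial vertices (`J₀`-self-dual lattices) — HONEST SCOPE: the trivial-norm class only (§2).
[cite: Kottwitz1986BaseChangeUnits, §1 p. 242; §3 pp. 246–248] [cite: Jacobowitz1962, §3 Thm. 3.1, §7] -/
theorem ncard_isSelfDualLattice_mul_inv_eq_ncard_std_of_epsNorm_eq_one {ϖ : E}
    (hτ : ∀ x, τ (τ x) = x) (hτ1 : τ ≠ RingHom.id E) (δ : GL (Fin 3) E) (hN : δ * UnitaryGroup.qsInvolution τ δ = 1)
    (hdet : ∃ z : E, z ≠ 0 ∧ ((((δ⁻¹ : GL (Fin 3) E)) : Matrix (Fin 3) (Fin 3) E)).det = τ z * z) :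
    {M : {M : Submodule 𝒪[E] (Fin 3 → E) // ∃ g : GL (Fin 3) E, M = latt (g : Matrix (Fin 3) (Fin 3) E)} |
        IsSelfDualLattice τ ϖ ((StdForm.antidiagonal 3).over E * (((δ⁻¹ : GL (Fin 3) E)) : Matrix (Fin 3) (Fin 3) E)) M.1}.ncard =
      {M : {M : Submodule 𝒪[E] (Fin 3 → E) // ∃ g : GL (Fin 3) E, M = latt (g : Matrix (Fin 3) (Fin 3) E)} |
        IsSelfDualLattice τ ϖ ((StdForm.antidiagonal 3).over E) M.1}.ncard := by
  obtain ⟨g₀, hg₀⟩ := (exists_formCongr_eq_antidiagonal_mul_inv_iff hτ hτ1 δ hN).2 hdet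
  exact ncard_isSelfDualLattice_mul_inv_eq_of_formCongr δ g₀ hg₀

end FrameCount

end Summit.HodgeConjecture.HodgeConjecture.R90.S6

end
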